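import Literature.NumberTheory.Automorphic.ResGLnCuspidalEigenclassOfRealisation
import Literature.NumberTheory.Automorphic.ResGLnSignTwistedReceptacle
import HarnessLib

/-!
# `ResGLnCohomology.cuspidalEigenclass_exists` from the realisation map into the cohomology of the
# FULL arithmetic group `GL_n(K)` — the literal shape of Borel–Wallach VII 2.7

Topic `NumberTheory/Automorphic`; namespace `Literature.NumberTheory.Automorphic.ResGLnCohomology`.
Theorems only (no definition, no named fact, no `sorry`).

`ResGLnCuspidalEigenclassOfRealisation` reduced the named fact `ResGLnCohomology.cuspidalEigenclass_exists`
to the hypothesis (R): a NON-ZERO Hecke-equivariant map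
`Φ : H^q(𝔤, K_∞; π ⊗ (E_λ ⊗ ε_S)) → H^q(GL_n(K)⁺, Fun(GL_n(𝔸_K^∞)/K_f(𝔫), E_λ)) = levelCohomology ℂ n K 𝔫 λ q`
on the `K_f(𝔫)`-invariant classes.  The comparison theorem as PRINTED [cite: BorelWallach2000, VII 2.2,
2.5, 2.7] is for a discrete subgroup of a Lie group with finitely many components and its FULL maximal
compact subgroup — for the tree's `(𝔤, K_∞)`-cohomology (full `K_∞ = ∏ O(n) × ∏ U(n)`) that is the
arithmetic group `GL_n(K)` (not `GL_n(K)⁺`), with the sign-twisted coefficients `E_λ ⊗ ε_S` restricting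
on `GL_n(K)` to `coeffRepTwist = E_λ ⊗ (ε_S ∘ det)` (`archCoeffRepSign_diagArch`), i.e. a map into the
twisted receptacle `levelCohomologyTwist n K 𝔫 λ S q = H^q(GL_n(K), Fun(GL_n(𝔸_K^∞)/K_f(𝔫), E_λ ⊗ ε_S))`
of `ResGLnSignTwistedReceptacle`.  Since restriction `resTwist : levelCohomologyTwist ⟶ levelCohomology`
along `GL_n(K)⁺ ≤ GL_n(K)` is INJECTIVE and Hecke-equivariant (`resTwist_injective`,
`resTwist_heckeTTwist`, loc. cit.), the following variant (R') of (R) suffices: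

> (R') for `π` cuspidal on `GL_n(𝔸_K)` of cohomological infinity type `λ^∨ + ρ` (`a`-multisets,
> embedding by embedding) with a `K(𝔫)`-fixed form off `W'` (`𝔫 ≠ 0`, `λ_τ` dominant) there are a set
> `S` of real places, a degree `q` and a `ℂ`-linear
> `Φ' : H^q(𝔤, K_∞; π ⊗ (E_λ ⊗ ε_S)) → H^q(GL_n(K), Fun(GL_n(𝔸_K^∞)/K_f(𝔫), E_λ ⊗ ε_S))`
> intertwining the `T_{v,i}`, `v ∤ 𝔫`, `i ≤ n`, on the `K_f(𝔫)`-invariant classes and non-zero on one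
> of them

— Borel–Wallach VII 2.7 with Shapiro over the cusps [cite: BorelWallach2000, VII 2.7]
[cite: GetzHahn2024, §15.5 (15.25)], Borel's injectivity of cuspidal cohomology in the bottom degree
[cite: Borel1983Regularization, Thm. 5.3 and Cor. 5.5] [cite: Franke1998, Thm. 18], and Clozel's
non-vanishing with the sign twist [cite: Clozel1990, Lemme 3.14 (p. 120)]
[cite: GrobnerRaghuram2014, §6 Thm. 26, Rem. 27].  THIS FILE proves

* `ResGLnCohomology.cuspidalEigenclass_exists_of_realisationFull (hreal : (R')) : cuspidalEigenclass_exists`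
  (compose `Φ'` with `resTwist` and apply `cuspidalEigenclass_exists_of_realisation`).

So `cuspidalEigenclass_exists_holds` is one line from EITHER a theorem (R) or a theorem (R').

## References

* A. Borel, N. Wallach (2000), VII 2.2, 2.5, 2.7. [BorelWallach2000]
* A. Borel, Duke Math. J. 50 (1983), Thm. 5.3, Cor. 5.5. [Borel1983Regularization]
* J. Franke, Ann. Sci. ÉNS 31 (1998), Thm. 18. [Franke1998]
* L. Clozel, *Motifs et formes automorphes* (1990), Lemme 3.14–3.15, §3.5. [Clozel1990]
* J. Getz, H. Hahn (GTM 300, 2024), §15.5 (15.25)–(15.28). [GetzHahn2024]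
* H. Grobner, A. Raghuram, Int. J. Number Theory 10 (2014) = arXiv:1102.1872, §6, §7. [GrobnerRaghuram2014]
-/

noncomputable section

open scoped Classical
open NumberField IsDedekindDomain

namespace Literature.NumberTheory.Automorphic

namespace ResGLnCohomology

open Literature.NumberTheory.DiophantineGeometry Literature.Barriers.Langlands RealMatrixGroup
open scoped MatrixGroups

-- The statement elaborates through the `cohomologyLamSign` / `levelCohomologyTwist` abbrev towers (as for
-- `cuspidalEigenclass_exists_of_realisation`): raise the heartbeat budget for this declaration only.
set_option maxHeartbeats 1000000 in
/-- **`ResGLnCohomology.cuspidalEigenclass_exists` from the realisation map into the cohomology of the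
FULL arithmetic group.**  Hypothesis `hreal` = (R') of the module docstring (NOT yet a theorem of the
tree: Borel–Wallach VII 2.7, Borel's injectivity in the bottom degree, Clozel's Lemme 3.14 with the
sign twist): a `ℂ`-linear `Φ' : H^q(𝔤, K_∞; π ⊗ (E_λ ⊗ ε_S)) → levelCohomologyTwist n K 𝔫 λ S q`
intertwining `T_{v,i}` (`heckeTLamSign`) with `T_{v,i}` (`heckeTTwist`) on the `K_f(𝔫)`-invariant
classes, `v ∤ 𝔫`, `i ≤ n`, and non-zero on some invariant class [cite: BorelWallach2000, VII 2.7]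
[cite: Borel1983Regularization, Thm. 5.3 and Cor. 5.5] [cite: Clozel1990, Lemme 3.14, Lemme 3.15, §3.5]
[cite: GrobnerRaghuram2014, §6 Rem. 27, §7.2–7.3].  Conclusion: the named fact, through
`cuspidalEigenclass_exists_of_realisation` with `Φ = resTwist ∘ Φ'` (`resTwist_injective`,
`resTwist_heckeTTwist`). [cite: Brown1982CohomologyGroups, III Prop. 10.1] -/
theorem cuspidalEigenclass_exists_of_realisationFull
    (hreal : ∀ (n : ℕ) (K : Type) [Field K] [NumberField K] (hcpt : isCompact_glFiniteIntegralLevel n K)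
      (𝔫 : Ideal (𝓞 K)) (lam : (K →+* ℂ) → Fin n → ℤ), 1 ≤ n → 𝔫 ≠ 0 →
      (∀ τ, Weight.IsDominant (lam τ)) →
      ∀ π : CuspidalAutomorphicRepData n K hcpt,
        (∃ T : InfinityType K n, π.1.HasInfinityType T ∧
          ∀ τ : K →+* ℂ, (T τ).map ArchWeight.a =
            (cohomologicalInfinityType n K (Weight.dual (lam τ)) τ).map ArchWeight.a) →
        (∃ φ ∈ π.1.W, φ ∉ π.1.W' ∧
          ∀ u ∈ principalCongruenceLevel n K 𝔫, rightTranslation (AdelicGroupData.gl n K) u φ = φ) →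
        ∃ (S : Finset {w : InfinitePlace K // w.IsReal}) (q : ℕ)
          (Φ' : π.cohomologyLamSign S lam q →ₗ[ℂ] levelCohomologyTwist n K 𝔫 lam S q),
          (∀ v : HeightOneSpectrum (𝓞 K), ¬ v.asIdeal ∣ 𝔫 → ∀ i ≤ n,
            ∀ ξ ∈ π.cohomologyLamSignLevel S lam (level n K 𝔫) q,
              Φ' (π.heckeTLamSign S lam (level n K 𝔫) q v i ξ) =
                heckeTTwist n K 𝔫 lam S q v i (Φ' ξ)) ∧
          ∃ ξ ∈ π.cohomologyLamSignLevel S lam (level n K 𝔫) q, Φ' ξ ≠ 0) :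
    cuspidalEigenclass_exists := by
  refine cuspidalEigenclass_exists_of_realisation ?_
  intro n K _ _ hcpt 𝔫 lam hn h𝔫 hlam π hT hφ
  obtain ⟨S, q, Φ', hΦ', ξ, hξ, hne⟩ := hreal n K hcpt 𝔫 lam hn h𝔫 hlam π hT hφ
  refine ⟨S, q, (resTwist n K 𝔫 lam S q).hom ∘ₗ Φ', fun v hv i hi ξ' hξ' => ?_, ξ, hξ, fun h0 => ?_⟩
  · rw [LinearMap.comp_apply, LinearMap.comp_apply, hΦ' v hv i hi ξ' hξ', resTwist_heckeTTwist]
  · refine hne (resTwist_injective n K 𝔫 lam S q ?_)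
    rw [map_zero]
    exact h0

end ResGLnCohomology

end Literature.NumberTheory.Automorphic

end
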